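import Summits.ValiantsHypothesis.ValiantsHypothesis.Theorems.LacunarySymmetroidMatrixDescartesCensusDoorA34NullTopLift

/-!
# `MatrixDescartes` census — DOOR A at `(3,4)`: the NULL-NULL LIFT (a chain-seventeen with BOTH end letters singular lifts to a nineteen)

HONEST FRAMING.  Object-search cell `pub-symmetroid`, route `LacunarySymmetroid`; this file sits beside ONE typed statement,
the route item `Theses.LacunarySymmetroid.DoorA34` (stmt-ValiantsHypothesis-19980, `= DoorA34 = PosRootLawAt 3 4 18`), which is
OPEN and asserted nowhere.  It composes the bottom lift (`…CensusDoorA34NullEndLift`) and the top lift (`…CensusDoorA34NullTopLift`):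

* `exists_altChain_of_nullBottom` — the bottom lift in CHAIN currency (same proof as `nineteen_of_nullBottom_eighteen`, keeping the
  chain): `S₀ ↦ S₀ + η kkᵀ` turns an alternation chain of `N + 1` points into one of `N + 2` points, on the same support.
* `nineteen_of_nullNull_seventeen` — **NULL-NULL LIFT at `(3,4)`**: on a support with `d 0 < d l < d 3` (`l = 1, 2`), if BOTH end
  letters are singular of adjugate rank (`det S₀ = det S₃ = 0`, `k₀ᵀ adj(S₀) k₀ ≠ 0`, `k₃ᵀ adj(S₃) k₃ ≠ 0`) and the pencil
  determinant carries an alternation chain of `N + 1` positive points, then perturbing the two end letters by `η₀ k₀k₀ᵀ` and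
  `η₃ k₃k₃ᵀ` (same support, still symmetric) gives `≥ N + 2` distinct positive det-roots.  With `N = 17`: a NULL-NULL SEVENTEEN
  LIFTS TO A NINETEEN.
* `no_nullNull_seventeen_of_posRootLawOn` — contrapositive in row currency.

With the A′ bridge (`…CensusDoorA34Lift`) this completes the boundary currency of `DoorA34`: ONE exact object on ANY support among
{nineteen, double-root eighteen, fully alternating eighteen, null-top / null-bottom chain-eighteen, null-null chain-seventeen} is a
kernel `¬DoorA34`.  NOTHING here asserts that such objects exist or do not exist; nothing bounds `ζ_sym(3,4)`; `DoorA34` stays OPEN;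
nothing bears on `MatrixDescartes` (stmt-ValiantsHypothesis-18050) or on `VP ≠ VNP`.

[folklore] Matrix determinant lemma; intermediate values near `0` and `∞`; no citation is needed.
-/

-- `Summit.ValiantsHypothesis.ValiantsHypothesis.…` repeats a component by the D-0017 layout
-- (single-conjunct summit), which the `dupNamespace` linter flags; the name is mandated.
set_option linter.dupNamespace false

namespace Summit.ValiantsHypothesis.ValiantsHypothesis.Theorems.LacunarySymmetroidMatrixDescartes.Census

open Polynomial Finset
open scoped BigOperators Polynomial Matrix
open Summit.ValiantsHypothesis.ValiantsHypothesis.Theorems.MatrixDescartes.Negative (PosRootLawAt)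

/-- **Bottom lift, chain currency.**  `d 0 < d l` (`l ≠ 0`), `det S₀ = 0`, `kᵀ adj(S₀) k ≠ 0`, an alternation chain of `N + 1`
positive points for the pencil determinant ⇒ for some `η`, the pencil with bottom letter `S₀ + η kkᵀ` carries an alternation chain of
`N + 2` positive points. [folklore] -/
theorem exists_altChain_of_nullBottom (d : Fin 4 → ℕ) (h0 : ∀ l, l ≠ 0 → d 0 < d l)
    (S : Fin 4 → Matrix (Fin 3) (Fin 3) ℝ) (hdet : (S 0).det = 0)
    (k : Fin 3 → ℝ) (hk : k ⬝ᵥ ((S 0).adjugate *ᵥ k) ≠ 0)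
    {N : ℕ} {s : ℝ} {a : Fin (N + 1) → ℝ}
    (hchain : AltChain ((∑ l, (X : ℝ[X]) ^ d l • (S l).map C).det) N s a) :
    ∃ η s' : ℝ, ∃ a' : Fin (N + 2) → ℝ, AltChain ((∑ l, (X : ℝ[X]) ^ d l •
      ((S l + if l = 0 then η • Matrix.vecMulVec k k else 0)).map C).det) (N + 1) s' a' := by
  classical
  have h0' : ∀ l, d 0 ≤ d l := fun l => by
    by_cases hl : l = 0
    · rw [hl]
    · exact (h0 l hl).le
  set P : Matrix (Fin 3) (Fin 3) ℝ[X] := ∑ l, (X : ℝ[X]) ^ d l • (S l).map C with hP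
  set Nm : Matrix (Fin 3) (Fin 3) ℝ[X] := ∑ l, (X : ℝ[X]) ^ (d l - d 0) • (S l).map C with hNm
  have hPN : P = (X : ℝ[X]) ^ d 0 • Nm := pencil_eq_X_pow_smul d S h0'
  set kC : Fin 3 → ℝ[X] := fun i => C (k i) with hkC
  set q₁ : ℝ[X] := kC ⬝ᵥ (Nm.adjugate *ᵥ kC) with hq₁
  set g : ℝ[X] := P.det with hg
  set r : ℝ[X] := X ^ d 0 * (kC ⬝ᵥ (P.adjugate *ᵥ kC)) with hr
  -- `g = X^{3 d₀} · det N`, `r = X^{3 d₀} · q₁`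
  have hg' : g = X ^ (3 * d 0) * Nm.det := by
    rw [hg, hPN, Matrix.det_smul, Fintype.card_fin, ← pow_mul, Nat.mul_comm]
  have hr' : r = X ^ (3 * d 0) * q₁ := by
    rw [hr, hPN, Matrix.adjugate_smul, Fintype.card_fin]
    show X ^ d 0 * (kC ⬝ᵥ ((((X : ℝ[X]) ^ d 0) ^ (3 - 1) • Nm.adjugate) *ᵥ kC)) = X ^ (3 * d 0) * q₁
    rw [Matrix.smul_mulVec, dotProduct_smul, smul_eq_mul, hq₁, ← mul_assoc, ← pow_mul, ← pow_add]
    congr 2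
    omega
  -- values at `0`: `(det N)(0) = det S₀ = 0`, `q₁(0) = kᵀ adj(S₀) k`
  have hN0 : (Polynomial.evalRingHom 0).mapMatrix Nm = S 0 := eval_zero_reduced_pencil d S h0
  have hdetN0 : (Nm.det).coeff 0 = 0 := by
    rw [Polynomial.coeff_zero_eq_eval_zero, ← Polynomial.coe_evalRingHom, RingHom.map_det, hN0, hdet]
  have hq0 : q₁.coeff 0 = k ⬝ᵥ ((S 0).adjugate *ᵥ k) := by
    set φ : ℝ[X] →+* ℝ := Polynomial.evalRingHom 0 with hφ
    have hk' : (⇑φ ∘ kC) = k := by funext i; simp [hφ, hkC]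
    have hmv : (⇑φ ∘ (Nm.adjugate *ᵥ kC)) = (φ.mapMatrix Nm).adjugate *ᵥ k := by
      funext i
      rw [Function.comp_apply, RingHom.map_mulVec, hk', ← RingHom.map_adjugate]
      rfl
    rw [Polynomial.coeff_zero_eq_eval_zero, ← Polynomial.coe_evalRingHom, ← hφ, hq₁, RingHom.map_dotProduct, hmv, hk',
      hN0]
  -- coefficient hypotheses of the lifting step at order `e = 3 d₀`
  have hgcoeff : ∀ n ≤ 3 * d 0, g.coeff n = 0 := by
    intro n hn
    rw [hg']
    rcases Nat.lt_or_ge n (3 * d 0) with hlt | hge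
    · exact Polynomial.coeff_X_pow_mul' _ _ _ |>.trans (if_neg (not_le.mpr hlt))
    · have heq : n = 3 * d 0 := le_antisymm hn hge
      rw [heq, Polynomial.coeff_X_pow_mul', if_pos le_rfl, Nat.sub_self, hdetN0]
  have hrcoeff : ∀ n < 3 * d 0, r.coeff n = 0 := by
    intro n hn
    rw [hr', Polynomial.coeff_X_pow_mul', if_neg (not_le.mpr hn)]
  have hre : r.coeff (3 * d 0) ≠ 0 := by
    rw [hr', Polynomial.coeff_X_pow_mul', if_pos le_rfl, Nat.sub_self, hq0]; exact hk
  -- the lifting step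
  have hs : s ≠ 0 := by
    intro h; have := hchain.2.2.2; rw [h, zero_mul] at this; exact lt_irrefl _ this
  obtain ⟨η₀, hη₀, H⟩ := altChain_lift_step g r (3 * d 0) hgcoeff hrcoeff hre N s a hchain
  obtain ⟨η, hη, hηb, hηs⟩ := exists_small_of_sign η₀ s (r.coeff (3 * d 0)) hη₀ hs hre
  obtain ⟨a', -, -, hchain'⟩ := H η hη hηb hηs
  have hid : ((∑ l, (X : ℝ[X]) ^ d l • ((S l + if l = 0 then η • Matrix.vecMulVec k k else 0)).map C)).det
      = g + C η * r := by
    rw [det_pencil_perturb_rankOne, hg, hr]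
  refine ⟨η, η * r.coeff (3 * d 0), a', ?_⟩
  rw [hid]
  exact hchain'

/-- **NULL-NULL LIFT at `(3,4)`.**  On a support with `d 0 < d l < d 3` for `l ∉ {0, 3}`… precisely `d 0 < d l` (`l ≠ 0`) and
`d l < d 3` (`l ≠ 3`): if both end letters are singular of adjugate rank and the pencil determinant carries an alternation chain of
`N + 1` positive points, then for some reals `η₀, η₃` the symmetric pencil with end letters `S₀ + η₀ k₀k₀ᵀ`, `S₃ + η₃ k₃k₃ᵀ` (same
support) has at least `N + 2` distinct positive det-roots.  With `N = 17`: a NULL-NULL SEVENTEEN LIFTS TO A NINETEEN. [folklore] -/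
theorem nineteen_of_nullNull_seventeen (d : Fin 4 → ℕ) (h0 : ∀ l, l ≠ 0 → d 0 < d l) (h3 : ∀ l, l ≠ 3 → d l < d 3)
    (S : Fin 4 → Matrix (Fin 3) (Fin 3) ℝ) (hdet0 : (S 0).det = 0) (hdet3 : (S 3).det = 0)
    (k₀ : Fin 3 → ℝ) (hk₀ : k₀ ⬝ᵥ ((S 0).adjugate *ᵥ k₀) ≠ 0)
    (k₃ : Fin 3 → ℝ) (hk₃ : k₃ ⬝ᵥ ((S 3).adjugate *ᵥ k₃) ≠ 0)
    {N : ℕ} {s : ℝ} {a : Fin (N + 1) → ℝ}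
    (hchain : AltChain ((∑ l, (X : ℝ[X]) ^ d l • (S l).map C).det) N s a) :
    ∃ η₀ η₃ : ℝ, N + 2 ≤ ((((∑ l, (X : ℝ[X]) ^ d l •
      (((S l + if l = 0 then η₀ • Matrix.vecMulVec k₀ k₀ else 0) + if l = 3 then η₃ • Matrix.vecMulVec k₃ k₃ else 0)).map C)).det
        ).roots.toFinset.filter (fun t => 0 < t)).card := by
  obtain ⟨η₀, s', a', hchain'⟩ := exists_altChain_of_nullBottom d h0 S hdet0 k₀ hk₀ hchain
  set S₁ : Fin 4 → Matrix (Fin 3) (Fin 3) ℝ := fun l => S l + if l = 0 then η₀ • Matrix.vecMulVec k₀ k₀ else 0 with hS₁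
  have h13 : S₁ 3 = S 3 := by simp [hS₁]
  have hdet3' : (S₁ 3).det = 0 := by rw [h13]; exact hdet3
  have hk₃' : k₃ ⬝ᵥ ((S₁ 3).adjugate *ᵥ k₃) ≠ 0 := by rw [h13]; exact hk₃
  obtain ⟨η₃, h⟩ := nineteen_of_nullTop_eighteen d h3 S₁ hdet3' k₃ hk₃' hchain'
  exact ⟨η₀, η₃, h⟩

/-- the doubly perturbed letters stay symmetric. [folklore] -/
theorem perturb_rankOne_both_isSymm (S : Fin 4 → Matrix (Fin 3) (Fin 3) ℝ) (hS : ∀ l, (S l).IsSymm) (k₀ k₃ : Fin 3 → ℝ)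
    (η₀ η₃ : ℝ) (l : Fin 4) :
    ((S l + if l = 0 then η₀ • Matrix.vecMulVec k₀ k₀ else 0) + if l = 3 then η₃ • Matrix.vecMulVec k₃ k₃ else 0).IsSymm :=
  perturb_rankOne_top_isSymm (fun l => S l + if l = 0 then η₀ • Matrix.vecMulVec k₀ k₀ else 0)
    (perturb_rankOne_isSymm S hS k₀ η₀) k₃ η₃ l

/-- **DOOR-A READING (null-null chain-seventeens).**  On a support with `d 0 < d l` (`l ≠ 0`), `d l < d 3` (`l ≠ 3`) where the row
`PosRootLawOn 3 4 18 d` holds, NO real symmetric `(3,4)` pencil with both end letters singular of adjugate rank carries an alternation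
chain of `18` positive points: it would lift to a nineteen on `d`. [folklore] -/
theorem no_nullNull_seventeen_of_posRootLawOn {d : Fin 4 → ℕ} (hrow : PosRootLawOn 3 4 18 d)
    (h0 : ∀ l, l ≠ 0 → d 0 < d l) (h3 : ∀ l, l ≠ 3 → d l < d 3)
    (S : Fin 4 → Matrix (Fin 3) (Fin 3) ℝ) (hS : ∀ l, (S l).IsSymm) (hdet0 : (S 0).det = 0) (hdet3 : (S 3).det = 0)
    (k₀ : Fin 3 → ℝ) (hk₀ : k₀ ⬝ᵥ ((S 0).adjugate *ᵥ k₀) ≠ 0)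
    (k₃ : Fin 3 → ℝ) (hk₃ : k₃ ⬝ᵥ ((S 3).adjugate *ᵥ k₃) ≠ 0) (s : ℝ) (a : Fin 18 → ℝ) :
    ¬ AltChain ((∑ l, (X : ℝ[X]) ^ d l • (S l).map C).det) 17 s a := by
  intro hchain
  obtain ⟨η₀, η₃, h19⟩ := nineteen_of_nullNull_seventeen d h0 h3 S hdet0 hdet3 k₀ hk₀ k₃ hk₃ hchain
  have := hrow _ (perturb_rankOne_both_isSymm S hS k₀ k₃ η₀ η₃)
  omega

end Summit.ValiantsHypothesis.ValiantsHypothesis.Theorems.LacunarySymmetroidMatrixDescartes.Census
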